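import Mathlib
import Summits.KontsevichZagierPeriods.Zeta5Search.ClusterValuation
import Summits.KontsevichZagierPeriods.Zeta5Search.PalindromicClassBounds
import Summits.KontsevichZagierPeriods.Zeta5Search.PalindromicClassBoundsProof
import Summits.KontsevichZagierPeriods.Zeta5Search.CasoratianClassBoundProof
import Summits.KontsevichZagierPeriods.Zeta5Search.MixedPairTermwiseProof
import Summits.KontsevichZagierPeriods.Zeta5Search.DenomLaw.OrbitCreditCasoratian
import Summits.KontsevichZagierPeriods.Zeta5Search.DenomLaw.ThresholdModelCasoratianLB
import Summits.KontsevichZagierPeriods.Zeta5Search.DenomLaw.ThresholdModelCasoratianK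

/-!
# ζ(5) search — DENOM-LAW: the threshold model, PART VI (THEOREM LB with rung K's rows), part B: `rowMinK`/`LB_K` on a deep cell, LB-K versus (CV), (CV) on the whole D region; kernel examples

Cell `pub-zeta5`, track DENOM-LAW (K1 typing order item (1), «ThresholdModel port»): denom-engine-d2 g16's kernel-checked scratch module
`denom-law/engine-d2/g16/lean/LevelCensusCasoratianK.lean` PART VI (THRESHOLD-X8; general half = `CasoratianKDev.lean`) filed VERBATIM in two parts by denom-prover-d1 g5.  Part B of 2 (= 22nd file).
HONEST FRAMING: systematic search; MODEL-side level combinatorics read against the tree's THEOREM LB / rung K / orbit bounds on deep cells; nothing about ζ(5); no γ; no irrationality claim; records in print UNMOVED.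
Below: engine-d2 g16's header of PART VI, then the deep-cell half.
-/

namespace Summit.KontsevichZagierPeriods.Zeta5Search.DenomLaw.ThresholdModel.Rho

/-! # PART VI — THEOREM LB WITH RUNG K's ROWS (`LB_K = VB + rowMinK`, and `LB_K⁺ = VB⁺ + rowMinK` with the tree's orbit
credit), and (CV) ON THE WHOLE D REGION: the pure octave-1 cells — Part V's one exception — carry the palindrome bonus, so the
OBSERVED law (CV) restricted to deep cells is a corollary of tree theorems with NO exception (denom-engine-d2 g16, scratch typing;
NOT a tree filing)

HONEST FRAMING: as Parts I–V — MODEL/structure side, elementary integer bookkeeping read against the tree's own computable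
objects, plus ONE assembly of ALREADY-PROVED tree theorems (X8-1): the valuation inputs are the tree's `palindromicClassKBound_holds`
(typer g9; LEMMA S / the palindromic `𝒦`-class bound), `multipoleClassKBound_holds`, `singlePoleClassKBound_holds`, `classNuBound_holds`,
the orbit-credit norm form `Orbit.padicNorm_coeffV_le_plus` / `Orbit.classNuPlus_shift_ge` (`DenomLaw/OrbitCredit*`, denom-theory-d3 g4 /
engine-d2 g4) and the moment lemmas, in the norm forms the tree already uses for THEOREM LB (`casoratianClassBound_holds`) and for
the CASORATIAN ORBIT BOUND (`casoratianOrbitBound_holds`); no leading digit is compared; no linear form is evaluated, no p-adic digit,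
no kernel VALUE of any form; nothing about ζ(5); no γ; no irrationality claim; records in print UNMOVED.

THE TREE'S OBJECTS: `classRowListPal b p s` (census g13's rung-K row list, `PalindromicClassBounds`: single-pole class `1`,
multipole class `T_x(s) = classBound b p x s = s + E_x + [IsPalindromic (classConfig b p x) ∧ s + E_x odd]`), `wLBpal` (rung K for
`W`, PROVED: `palindromicClassBoundW_holds`), `palUnit` (`MixedPairs`), `vbMin` / `rowMin` / `casLB` (THEOREM LB), `Orbit.vbPlus` /
`Orbit.casLBPlus` (`VB⁺ = min (ν_x + credit_x)`, `LB⁺ = VB⁺ + rowMin`, PROVED: `casoratianOrbitBound_holds`, window `5 ≤ p ≤ b₀ < p² − 2`).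

## What is proved here (kernel-checked)
* (X8-1) **THEOREM LB-K** (general, tree-level; every `b`, `b + e_j` in the Brown–Zudilin polytope, every prime `p ≥ 5` with
  `p² > b₀ + 2`, `Cas_j(b) ≠ 0`): with `rowMinK b p := min (classRowListPal b p 3 ++ [0 | p > d])` (THEOREM LB's row term with
  rung K's rows) and **`LB_K := VB + rowMinK`** (`casLBK`), **`casLBK_le_padicValRat_casoratian : LB_K(b,p) ≤ v_p(Cas_j(b))`**;
  and for `5 ≤ p ≤ b₀` also **`LB_K⁺ := VB⁺ + rowMinK ≤ v_p(Cas_j(b))`** (`casLBKPlus_le_padicValRat_casoratian`) — both credits at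
  once.  The proof is THEOREM LB's assembly (`casoratian_bound_of_rowMinK`) with the ROW BOUNDS `‖𝒦_x(b)‖, ‖𝒦_x(b+e_j)‖ ≤ p^{−rowMinK}`
  (`padicNorm_classK_le_rowK`): single-pole rows by Theorem A′, multipole rows by the tree's `padicNorm_classK_le_pal` /
  `padicNorm_classK_shift_le_pal` (an unhit class keeps its configuration under `e_j`, a hit one gains a unit of exponent), and
  `rowMinK ≤ 1` always (`rowMinK_le_one`, the degree count `Σ_x E_x = −(2d+5)`), which covers the one configuration where
  `T_x(3)` exceeds `3 + E_x + palUnit` (palindromic, `E_x` even `≥ −2`).  Comparisons: `casLB_le_casLBK` (`LB ≤ LB_K`),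
  `casLBPlus_le_casLBKPlus` (`LB⁺ ≤ LB_K⁺`), `casLBK_le_casLBKPlus` (`LB_K ≤ LB_K⁺`).  DIGIT-FREE; like LB itself, LB-K uses NO
  cancellation between the two products of the minor (it is dominated by `min(wLBpal(b⁺) + VB(b), wLBpal(b) + VB(b⁺))`).
* (X8-2) ON A DEEP CELL (Part I's `BCell` at `q = (m−1)p`, `m ≥ 1`, dominant class `u₀`, `E_min = score(u₀) − (4m+8)`):
  **`rowMinK_of_deep_all`: `rowMinK = some (3 + E_min + 1)` if EVERY dominant class `v` fires the bonus (`v ≠ 0 ∧ L(v) = R(v) ∧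
  n₊(v) = n₋(v)`, Part IV's palindrome criterion), `rowMinK_of_deep_not`: `= some (3 + E_min)` otherwise** (Part IV's
  `minRowPal_eq_of_all / _of_not`); hence **`casLBK_of_deep_all`: `LB_K = 2·E_min + 4`**, `casLBK_of_deep_not`: `LB_K = 2·E_min + 3 = LB`,
  and `casLBK_eq_wLBpal_add`: **`LB_K = wLBpal + E_min`** — the product of the `V`-floor and rung K for `W`, term by term.
* (X8-3) **THE PURE CELLS FIRE** (`fire_of_score_zero`: `score(v) = 0 ⇒ v ≠ 0 ∧ L = R ∧ n₊ = n₋`; `score_pos_of_not_fire`):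
  **`casLBK_of_pure`: on a cell with a class of score `0`, `LB_K = 2·E_min + 4 = refund − N_p + (13m − 13)`**; and in general
  **`cv_add_le_casLBK_of_deep`: `refund − N_p + (13m − 13) ≤ LB_K` on EVERY deep cell** (if some dominant class does not fire its
  score is positive, the cell is not pure, `π + 2·score ≥ 22` and `LB_K = LB` suffices), so **`cv_le_casLBK_of_deep`:
  `refund − N_p ≤ LB_K` on every deep cell of every octave** — Part V's exception is gone.
* (X8-4) **(CV) ON THE WHOLE D REGION** (`casoratianValuationLaw_of_deepCell`, `casoratianValuationLaw_on_D`): for every deep tree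
  cell of any octave `m ≥ 1` and the hypotheses of `CasoratianValuationLaw` (polytope for `b` and `b + e_j`, `1 ≤ j ≤ 7`, prime
  `p ≥ 5`, `p² > b₀ + 2`, `Cas_j(b) ≠ 0`): **`refund − N_p ≤ v_p(Cas_j(b))`**, indeed `+ (13m − 13)` (`casoratianValuationLaw_of_deep_K`);
  `casoratianValuationLaw_of_pure_m_one`: on the pure octave-1 cells `LB_K = refund − N_p` exactly.  So the OBSERVED law (CV)
  (`@[conjecture]` in the tree) RESTRICTED TO THE D REGION is a consequence of theorems already in the tree; what it took beyond
  Part V was not a `V·W` digit cancellation but rung K's unit on the `𝒦`-rows of the dominant classes (two full order-6 poles form a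
  palindromic configuration with even `E_x = −12`: LEMMA S), carried to `b + e_j` by the persistence of unhit configurations.
Kernel examples (`decide` on the tree's definitions): `pureCell = (20; 4⁷)` at `p = 11`: `rowMinK = some (−8)`, **`LB_K = −20 =
refund − N_p`** (Part V: `LB = −21`), the tree's orbit credit ALSO supplies the unit (`VB⁺ = −11`, `LB⁺ = −20`), and both together
`LB_K⁺ = −19`; `palCell = (30; 12,9,9,7,7,7,7)`: `LB = −17 < LB_K = LB⁺ = −16 < LB_K⁺ = −15` (`refund − N_p = −18`); `exCell =
(28; 10,9,9,8,7,7,7)`: no bonus, all four bounds `−13`.  ENGINE-SIDE EXACT VALUES (gen-2 g6 `pf.py` kernel, `code/d2g16/lbk_exact16.py`;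
MODEL-side exact rational arithmetic of the cell's own dual forms, no γ): `v₁₁(Cas_j(pureCell)) = −17` for every `j` (`v₁₁(W) = −8 =
wLBpal`, `v₁₁(V) = −11 = VB⁺`, so the minor cancels two further units beyond the product `−19`), `v₁₁(Cas_j(palCell)) = −14`,
`v₁₁(Cas_j(exCell)) = −13 = LB`; exhaustive `b₀ ≤ 12` (78,472 triples `(b,p,j)`), the (1,11) deep block (18,669 triples) and the 182 pure cells at
`p = 11, 13`: 0 violations of LB / LB_K / LB⁺ / LB_K⁺ — see THRESHOLD-X8 §3.
-/

/-! ### (X8-2) `rowMinK` and `LB_K` on a deep cell: rung K's row minimum (Part IV `minRowPal_eq_of_all / _of_not`) -/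

section DeepCasK
variable {b : ℕ → ℤ} {p : ℕ} {m u₀ : ℤ}

open Summit.KontsevichZagierPeriods.Zeta5Search.ClusterValuation (classExp classPoleCount classNu vbMin rowMin casLB
  classBound classRowListPal wLB wLBpal casoratianClassBound_holds)
open Summit.KontsevichZagierPeriods.Zeta5Search.ClusterValuation.Orbit (vbPlus casLBPlus casoratianOrbitBound_holds)
open Summit.KontsevichZagierPeriods.Zeta5Search.CasoratianValuation (InPolytope pairFloors refund shift casoratian)
open Summit.KontsevichZagierPeriods.Zeta5Search.WedgeDictionary (dOf coeffV)

/-- **A CLASS OF SCORE `0` FIRES THE BONUS**: `score(v) = 0` means no frame root (`L = R = 0`), no numerator end inside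
(`n₊ = n₋ = 0`) and `v` off the centre — so `v ≠ 0`, `L(v) = R(v)`, `n₊(v) = n₋(v)` (the mirror-symmetric, off-centre case
of Part IV's palindrome criterion). -/
theorem fire_of_score_zero (p R0 : ℤ) (r : Fin 7 → ℤ) {v : ℤ} (hs : score p R0 r v = 0) :
    v ≠ 0 ∧ L p r v = R p r v ∧ np p R0 v = nm p R0 v := by
  have hL := countLt_nonneg r (v + p)
  have hR := countLt_nonneg r (p - v)
  have h1 := indic_nonneg (2 * p - R0 ≤ v)
  have h2 := indic_nonneg (v ≤ R0 - 2 * p)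
  have h3 := indic_nonneg (v = 0 ∨ v = p)
  unfold score delta centre L R np nm at hs
  refine ⟨fun hv => ?_, by unfold L R; omega, by unfold np nm; omega⟩
  have : indic (v = 0 ∨ v = p) = 1 := indic_pos (Or.inl hv)
  omega

/-- conversely a dominant class that does NOT fire has positive score. -/
theorem score_pos_of_not_fire (p R0 : ℤ) (r : Fin 7 → ℤ) {v : ℤ}
    (hno : ¬ (v ≠ 0 ∧ L p r v = R p r v ∧ np p R0 v = nm p R0 v)) : 1 ≤ score p R0 r v := by
  have hs := score_nonneg p R0 r v
  by_contra hlt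
  exact hno (fire_of_score_zero p R0 r (by omega))

/-- **`rowMinK = 3 + E_min + 1` ON A DEEP CELL WHOSE DOMINANT CLASSES ALL FIRE** (rung K's minimum, Part IV
`minRowPal_eq_of_all` at `s = 3`; the list is nonempty because the dominant residue contributes its multipole row). -/
theorem rowMinK_of_deep_all (hB : BCell (p : ℤ) ((m - 1) * p) (b 0) (lowerB b)) (hm : 1 ≤ m)
    (hd₀ : IsDominant (p : ℤ) (R0b p m (b 0)) (rhob p m (b 0) (lowerB b)) u₀)
    (hall : ∀ v, IsDominant (p : ℤ) (R0b p m (b 0)) (rhob p m (b 0) (lowerB b)) v →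
      (v ≠ 0 ∧ L (p : ℤ) (rhob p m (b 0) (lowerB b)) v = R (p : ℤ) (rhob p m (b 0) (lowerB b)) v ∧
        np (p : ℤ) (R0b p m (b 0)) v = nm (p : ℤ) (R0b p m (b 0)) v)) :
    rowMinK b p = some (3 + (score (p : ℤ) (R0b p m (b 0)) (rhob p m (b 0) (lowerB b)) u₀ - (4 * m + 8)) + 1) := by
  have hD : DeepCell (p : ℤ) (R0b p m (b 0)) (rhob p m (b 0) (lowerB b)) := by
    rw [rhob_eq_rhoOf, R0b_eq_R0Of]; exact hB.deepCell
  have hp1 : (1 : ℤ) ≤ p := hD.levelBox.one_le_p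
  obtain ⟨x₀, hx₀p, hx₀⟩ := exists_residue_lt (m := m) (b0 := b 0) hp1 u₀
  have hpc₀ : 2 ≤ classPoleCount b p x₀ := by have := classPoleCount_of_dominant hB hm hd₀ hx₀; omega
  have hmem := mem_rowListK b (z := classBound b p x₀ 3) (by exact_mod_cast hx₀p) (by rw [if_neg (by omega), if_pos hpc₀])
  have hne : (classRowListPal b p 3 ++ (if dOf b < (p : ℤ) then [0] else [])) ≠ [] := List.ne_nil_of_mem hmem
  unfold rowMinK
  rw [min?_eq_some_getD hne, minRowPal_eq_of_all hB hm (by decide) (by omega) hd₀ hall (dOf b < (p : ℤ))]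
  push_cast
  ring_nf

/-- **`rowMinK = 3 + E_min` ON A DEEP CELL WITH A NON-FIRING DOMINANT CLASS** (Part IV `minRowPal_eq_of_not`): there
rung K's rows give THEOREM LB's `rowMin` back. -/
theorem rowMinK_of_deep_not (hB : BCell (p : ℤ) ((m - 1) * p) (b 0) (lowerB b)) (hm : 1 ≤ m) {u₁ : ℤ}
    (hd₁ : IsDominant (p : ℤ) (R0b p m (b 0)) (rhob p m (b 0) (lowerB b)) u₁)
    (hno : ¬ (u₁ ≠ 0 ∧ L (p : ℤ) (rhob p m (b 0) (lowerB b)) u₁ = R (p : ℤ) (rhob p m (b 0) (lowerB b)) u₁ ∧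
        np (p : ℤ) (R0b p m (b 0)) u₁ = nm (p : ℤ) (R0b p m (b 0)) u₁)) :
    rowMinK b p = some (3 + (score (p : ℤ) (R0b p m (b 0)) (rhob p m (b 0) (lowerB b)) u₁ - (4 * m + 8))) := by
  have hD : DeepCell (p : ℤ) (R0b p m (b 0)) (rhob p m (b 0) (lowerB b)) := by
    rw [rhob_eq_rhoOf, R0b_eq_R0Of]; exact hB.deepCell
  have hp1 : (1 : ℤ) ≤ p := hD.levelBox.one_le_p
  obtain ⟨x₁, hx₁p, hx₁⟩ := exists_residue_lt (m := m) (b0 := b 0) hp1 u₁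
  have hpc₁ : 2 ≤ classPoleCount b p x₁ := by have := classPoleCount_of_dominant hB hm hd₁ hx₁; omega
  have hmem := mem_rowListK b (z := classBound b p x₁ 3) (by exact_mod_cast hx₁p) (by rw [if_neg (by omega), if_pos hpc₁])
  have hne : (classRowListPal b p 3 ++ (if dOf b < (p : ℤ) then [0] else [])) ≠ [] := List.ne_nil_of_mem hmem
  unfold rowMinK
  rw [min?_eq_some_getD hne, minRowPal_eq_of_not hB hm (by decide) (by omega) hd₁ hno (dOf b < (p : ℤ))]
  push_cast
  ring_nf

/-- **`LB_K = 2·E_min + 4` when every dominant class fires** — one more than THEOREM LB's `casLB = 2·E_min + 3`. -/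
theorem casLBK_of_deep_all (hB : BCell (p : ℤ) ((m - 1) * p) (b 0) (lowerB b)) (hm : 1 ≤ m)
    (hd₀ : IsDominant (p : ℤ) (R0b p m (b 0)) (rhob p m (b 0) (lowerB b)) u₀)
    (hall : ∀ v, IsDominant (p : ℤ) (R0b p m (b 0)) (rhob p m (b 0) (lowerB b)) v →
      (v ≠ 0 ∧ L (p : ℤ) (rhob p m (b 0) (lowerB b)) v = R (p : ℤ) (rhob p m (b 0) (lowerB b)) v ∧
        np (p : ℤ) (R0b p m (b 0)) v = nm (p : ℤ) (R0b p m (b 0)) v)) :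
    casLBK b p = 2 * (score (p : ℤ) (R0b p m (b 0)) (rhob p m (b 0) (lowerB b)) u₀ - (4 * m + 8)) + 4 := by
  simp only [casLBK, vbMin_of_deep hB hm hd₀, rowMinK_of_deep_all hB hm hd₀ hall]
  ring

/-- **`LB_K = 2·E_min + 3 = LB` when some dominant class does not fire.** -/
theorem casLBK_of_deep_not (hB : BCell (p : ℤ) ((m - 1) * p) (b 0) (lowerB b)) (hm : 1 ≤ m) {u₁ : ℤ}
    (hd₁ : IsDominant (p : ℤ) (R0b p m (b 0)) (rhob p m (b 0) (lowerB b)) u₁)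
    (hno : ¬ (u₁ ≠ 0 ∧ L (p : ℤ) (rhob p m (b 0) (lowerB b)) u₁ = R (p : ℤ) (rhob p m (b 0) (lowerB b)) u₁ ∧
        np (p : ℤ) (R0b p m (b 0)) u₁ = nm (p : ℤ) (R0b p m (b 0)) u₁)) :
    casLBK b p = 2 * (score (p : ℤ) (R0b p m (b 0)) (rhob p m (b 0) (lowerB b)) u₁ - (4 * m + 8)) + 3 := by
  simp only [casLBK, vbMin_of_deep hB hm hd₁, rowMinK_of_deep_not hB hm hd₁ hno]
  ring

/-- `LB_K = wLBpal + E_min`: on the D region THEOREM LB-K is the product of the `V`-floor and rung K for `W`, term by term. -/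
theorem casLBK_eq_wLBpal_add (hB : BCell (p : ℤ) ((m - 1) * p) (b 0) (lowerB b)) (hm : 1 ≤ m)
    (hd₀ : IsDominant (p : ℤ) (R0b p m (b 0)) (rhob p m (b 0) (lowerB b)) u₀) :
    casLBK b p = wLBpal b p + (score (p : ℤ) (R0b p m (b 0)) (rhob p m (b 0) (lowerB b)) u₀ - (4 * m + 8)) := by
  by_cases hall : ∀ v, IsDominant (p : ℤ) (R0b p m (b 0)) (rhob p m (b 0) (lowerB b)) v →
      (v ≠ 0 ∧ L (p : ℤ) (rhob p m (b 0) (lowerB b)) v = R (p : ℤ) (rhob p m (b 0) (lowerB b)) v ∧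
        np (p : ℤ) (R0b p m (b 0)) v = nm (p : ℤ) (R0b p m (b 0)) v)
  · rw [casLBK_of_deep_all hB hm hd₀ hall, wLBpal_of_deep_all hB hm hd₀ hall]; ring
  · push Not at hall
    obtain ⟨u₁, hd₁, hno⟩ := hall
    have hno' : ¬ (u₁ ≠ 0 ∧ L (p : ℤ) (rhob p m (b 0) (lowerB b)) u₁ = R (p : ℤ) (rhob p m (b 0) (lowerB b)) u₁ ∧
        np (p : ℤ) (R0b p m (b 0)) u₁ = nm (p : ℤ) (R0b p m (b 0)) u₁) := fun h => hno h.1 h.2.1 h.2.2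
    rw [casLBK_of_deep_not hB hm hd₁ hno', wLBpal_of_deep_not hB hm hd₁ hno', score_eq_of_dominant hd₁ hd₀]; ring

/-! ### (X8-3) THEOREM LB-K versus the (CV) law on a deep cell: no exceptional cells left -/

/-- **`LB_K − (refund − N_p) = 13m + π(ρ) + 2·score(u₀) − 34` when every dominant class fires.** -/
theorem casLBK_sub_cv_of_deep_all (hB : BCell (p : ℤ) ((m - 1) * p) (b 0) (lowerB b)) (hm : 1 ≤ m)
    (hd₀ : IsDominant (p : ℤ) (R0b p m (b 0)) (rhob p m (b 0) (lowerB b)) u₀)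
    (hall : ∀ v, IsDominant (p : ℤ) (R0b p m (b 0)) (rhob p m (b 0) (lowerB b)) v →
      (v ≠ 0 ∧ L (p : ℤ) (rhob p m (b 0) (lowerB b)) v = R (p : ℤ) (rhob p m (b 0) (lowerB b)) v ∧
        np (p : ℤ) (R0b p m (b 0)) v = nm (p : ℤ) (R0b p m (b 0)) v)) :
    casLBK b p - (refund b p - pairFloors b p) =
      13 * m + pairHigh (p : ℤ) (rhob p m (b 0) (lowerB b)) +
        2 * score (p : ℤ) (R0b p m (b 0)) (rhob p m (b 0) (lowerB b)) u₀ - 34 := by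
  rw [casLBK_of_deep_all hB hm hd₀ hall, refund_of_deep hB hm, pairFloors_of_deep hB]; ring

/-- **THE PURE CELLS FIRE**: if some class has score `0` (the pure cells of Part V, X7-9), then EVERY dominant class has score
`0` and fires the bonus, so `LB_K = 2·E_min + 4 = (refund − N_p) + (13m − 13)` there — the unit THEOREM LB was missing. -/
theorem casLBK_of_pure (hB : BCell (p : ℤ) ((m - 1) * p) (b 0) (lowerB b)) (hm : 1 ≤ m)
    (hd₀ : IsDominant (p : ℤ) (R0b p m (b 0)) (rhob p m (b 0) (lowerB b)) u₀)
    (hs₀ : score (p : ℤ) (R0b p m (b 0)) (rhob p m (b 0) (lowerB b)) u₀ = 0) :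
    casLBK b p = 2 * (0 - (4 * m + 8)) + 4 ∧
      casLBK b p = refund b p - pairFloors b p + (13 * m - 13) := by
  have hD : DeepCell (p : ℤ) (R0b p m (b 0)) (rhob p m (b 0) (lowerB b)) := by
    rw [rhob_eq_rhoOf, R0b_eq_R0Of]; exact hB.deepCell
  have hall : ∀ v, IsDominant (p : ℤ) (R0b p m (b 0)) (rhob p m (b 0) (lowerB b)) v →
      (v ≠ 0 ∧ L (p : ℤ) (rhob p m (b 0) (lowerB b)) v = R (p : ℤ) (rhob p m (b 0) (lowerB b)) v ∧
        np (p : ℤ) (R0b p m (b 0)) v = nm (p : ℤ) (R0b p m (b 0)) v) := fun v hv =>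
    fire_of_score_zero _ _ _ (by rw [score_eq_of_dominant hv hd₀, hs₀])
  have h21 := (hD.twentyone_le_pairHigh_add_two_score u₀).1
  have hπ : pairHigh (p : ℤ) (rhob p m (b 0) (lowerB b)) = 21 := by
    have := hD.pairHigh_bounds; omega
  refine ⟨by rw [casLBK_of_deep_all hB hm hd₀ hall, hs₀], ?_⟩
  have h := casLBK_sub_cv_of_deep_all hB hm hd₀ hall
  rw [hπ, hs₀] at h
  linarith

/-- **`refund − N_p + (13m − 13) ≤ LB_K` ON EVERY DEEP CELL** — one more than THEOREM LB's slack `13m − 14` (Part V): if every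
dominant class fires, `LB_K = LB + 1`; if one does not, its score is positive, so the cell is not pure and `π + 2·score ≥ 22`. -/
theorem cv_add_le_casLBK_of_deep (hB : BCell (p : ℤ) ((m - 1) * p) (b 0) (lowerB b)) (hm : 1 ≤ m) :
    refund b p - pairFloors b p + (13 * m - 13) ≤ casLBK b p := by
  have hD : DeepCell (p : ℤ) (R0b p m (b 0)) (rhob p m (b 0) (lowerB b)) := by
    rw [rhob_eq_rhoOf, R0b_eq_R0Of]; exact hB.deepCell
  obtain ⟨u₀, hd₀⟩ := hD.exists_dominant
  obtain ⟨h21, heq⟩ := hD.twentyone_le_pairHigh_add_two_score u₀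
  by_cases hall : ∀ v, IsDominant (p : ℤ) (R0b p m (b 0)) (rhob p m (b 0) (lowerB b)) v →
      (v ≠ 0 ∧ L (p : ℤ) (rhob p m (b 0) (lowerB b)) v = R (p : ℤ) (rhob p m (b 0) (lowerB b)) v ∧
        np (p : ℤ) (R0b p m (b 0)) v = nm (p : ℤ) (R0b p m (b 0)) v)
  · have h := casLBK_sub_cv_of_deep_all hB hm hd₀ hall
    linarith
  · push Not at hall
    obtain ⟨u₁, hd₁, hno⟩ := hall
    have hno' : ¬ (u₁ ≠ 0 ∧ L (p : ℤ) (rhob p m (b 0) (lowerB b)) u₁ = R (p : ℤ) (rhob p m (b 0) (lowerB b)) u₁ ∧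
        np (p : ℤ) (R0b p m (b 0)) u₁ = nm (p : ℤ) (R0b p m (b 0)) u₁) := fun h => hno h.1 h.2.1 h.2.2
    have hs₁ := score_pos_of_not_fire _ _ _ hno'
    have hsc : score (p : ℤ) (R0b p m (b 0)) (rhob p m (b 0) (lowerB b)) u₁ =
        score (p : ℤ) (R0b p m (b 0)) (rhob p m (b 0) (lowerB b)) u₀ := score_eq_of_dominant hd₁ hd₀
    have hK := casLBK_of_deep_not hB hm hd₁ hno'
    have hLB := casLB_sub_cv_of_deep hB hm hd₀
    have hKLB : casLBK b p = casLB b p := by rw [hK, casLB_of_deep hB hm hd₀, hsc]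
    have h22 : 22 ≤ pairHigh (p : ℤ) (rhob p m (b 0) (lowerB b)) +
        2 * score (p : ℤ) (R0b p m (b 0)) (rhob p m (b 0) (lowerB b)) u₀ := by
      by_contra hlt
      have := (heq (by omega)).2
      omega
    rw [hKLB]
    linarith

/-- **(CV)'s RIGHT-HAND SIDE IS BELOW `LB_K` ON EVERY DEEP CELL** (every octave `m ≥ 1`, pure or not). -/
theorem cv_le_casLBK_of_deep (hB : BCell (p : ℤ) ((m - 1) * p) (b 0) (lowerB b)) (hm : 1 ≤ m) :
    refund b p - pairFloors b p ≤ casLBK b p := by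
  have h := cv_add_le_casLBK_of_deep hB hm
  have : (0 : ℤ) ≤ 13 * m - 13 := by omega
  linarith

/-! ### (X8-4) (CV) on the WHOLE D region is a corollary of tree theorems (THEOREM LB-K) -/

/-- **`v_p(Cas_j(b)) ≥ refund − N_p + (13m − 13)` ON EVERY DEEP CELL** (THEOREM LB-K read on a deep cell; Part V had `13m − 14`
from THEOREM LB). -/
theorem casoratianValuationLaw_of_deep_K (hB : BCell (p : ℤ) ((m - 1) * p) (b 0) (lowerB b)) (hm : 1 ≤ m)
    (hb : InPolytope b) {j : ℕ} (hj1 : 1 ≤ j) (hj7 : j ≤ 7) (hb' : InPolytope (shift b j)) (hprime : p.Prime)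
    (hp5 : 5 ≤ p) (hwin : (b 0 + 2 : ℤ) < (p : ℤ) ^ 2) (hcas : casoratian b j ≠ 0) :
    refund b p - pairFloors b p + (13 * m - 13) ≤ padicValRat p (casoratian b j) :=
  le_trans (cv_add_le_casLBK_of_deep hB hm) (casLBK_le_padicValRat_casoratian b hb hj1 hj7 hb' hprime hp5 hwin hcas)

/-- **THE OBSERVED LAW (CV) HOLDS AT EVERY DEEP CELL** — `CasoratianValuationLaw` (`@[conjecture]` in the tree) restricted to
the D region (Part I's `BCell`, any octave `m ≥ 1`), with exactly its own hypotheses, is a consequence of the tree's PROVED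
`palindromicClassKBound_holds` / `multipoleClassKBound_holds` / `singlePoleClassKBound_holds` / `classNuBound_holds` and the
moment lemmas, through THEOREM LB-K.  No pure-cell exception remains. -/
theorem casoratianValuationLaw_of_deepCell (hB : BCell (p : ℤ) ((m - 1) * p) (b 0) (lowerB b)) (hm : 1 ≤ m)
    (hb : InPolytope b) {j : ℕ} (hj1 : 1 ≤ j) (hj7 : j ≤ 7) (hb' : InPolytope (shift b j)) (hprime : p.Prime)
    (hp5 : 5 ≤ p) (hwin : (b 0 + 2 : ℤ) < (p : ℤ) ^ 2) (hcas : casoratian b j ≠ 0) :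
    refund b p - pairFloors b p ≤ padicValRat p (casoratian b j) :=
  le_trans (cv_le_casLBK_of_deep hB hm) (casLBK_le_padicValRat_casoratian b hb hj1 hj7 hb' hprime hp5 hwin hcas)

/-- The same statement with the binders of `CasoratianValuationLaw` in front: **(CV) ON THE D REGION**. -/
theorem casoratianValuationLaw_on_D :
    ∀ (b : ℕ → ℤ) (j p : ℕ) (m : ℤ), BCell (p : ℤ) ((m - 1) * p) (b 0) (lowerB b) → 1 ≤ m →
      InPolytope b → 1 ≤ j → j ≤ 7 → InPolytope (shift b j) → p.Prime → 5 ≤ p → (b 0 + 2 : ℤ) < (p : ℤ) ^ 2 →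
        casoratian b j ≠ 0 → refund b p - pairFloors b p ≤ padicValRat p (casoratian b j) :=
  fun _ _ _ _ hB hm hb hj1 hj7 hb' hprime hp5 hwin hcas =>
    casoratianValuationLaw_of_deepCell hB hm hb hj1 hj7 hb' hprime hp5 hwin hcas

/-- and the pure octave-1 cells specifically (Part V's exception, `π = 21 ∧ score(u₀) = 0`): (CV) holds there with `LB_K = refund − N_p`
exactly (`casLBK_of_pure` at `m = 1`). -/
theorem casoratianValuationLaw_of_pure_m_one (hB : BCell (p : ℤ) ((1 - 1) * p) (b 0) (lowerB b))
    (hd₀ : IsDominant (p : ℤ) (R0b p 1 (b 0)) (rhob p 1 (b 0) (lowerB b)) u₀)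
    (hs₀ : score (p : ℤ) (R0b p 1 (b 0)) (rhob p 1 (b 0) (lowerB b)) u₀ = 0)
    (hb : InPolytope b) {j : ℕ} (hj1 : 1 ≤ j) (hj7 : j ≤ 7) (hb' : InPolytope (shift b j)) (hprime : p.Prime)
    (hp5 : 5 ≤ p) (hwin : (b 0 + 2 : ℤ) < (p : ℤ) ^ 2) (hcas : casoratian b j ≠ 0) :
    casLBK b p = refund b p - pairFloors b p ∧ refund b p - pairFloors b p ≤ padicValRat p (casoratian b j) := by
  have h := (casLBK_of_pure hB le_rfl hd₀ hs₀).2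
  exact ⟨by rw [h]; ring, casoratianValuationLaw_of_deepCell hB le_rfl hb hj1 hj7 hb' hprime hp5 hwin hcas⟩

end DeepCasK

/-! ### Kernel examples (`decide` on the tree's definitions): the four digit-free Casoratian bounds on Part V's cells -/

section CasKExamples

open Summit.KontsevichZagierPeriods.Zeta5Search.ClusterValuation (vbMin rowMin casLB wLBpal classBound classConfig
  IsPalindromic classExp classPoleCount)
open Summit.KontsevichZagierPeriods.Zeta5Search.ClusterValuation.Orbit (vbPlus casLBPlus)
open Summit.KontsevichZagierPeriods.Zeta5Search.CasoratianValuation (pairFloors refund)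

/-- `pureCell = (20; 4⁷)` at `p = 11` (Part V: `VB = −12`, `rowMin = −9`, `LB = −21 < −20 = refund − N_p`): the dominant residues
`x = 4, 5` are two-point classes `(−6, −6)` — palindromic, `E_x = −12` even — so rung K's row is `T_x(3) = −8`, `rowMinK = −8` and
**`LB_K = −20 = refund − N_p`**: (CV) on this pure cell IS a corollary of tree theorems (THEOREM LB-K). -/
example : classBound pureCell 11 4 3 = -8 ∧ IsPalindromic (classConfig pureCell 11 4) ∧ classBound pureCell 11 5 3 = -8 ∧
    rowMinK pureCell 11 = some (-8) ∧ casLBK pureCell 11 = -20 ∧ refund pureCell 11 - pairFloors pureCell 11 = -20 := by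
  refine ⟨by decide, by decide, by decide, by decide, by decide, by decide⟩

/-- … the tree's ORBIT CREDIT (`DenomLaw/OrbitCredit`, PROVED `casoratianOrbitBound_holds`) supplies the same unit on the `V` side
(`VB⁺ = −11`, `LB⁺ = −20`), and both credits together give `LB_K⁺ = −19`.  (Engine-side exact value: `v₁₁(Cas_j) = −17`, all `j`.) -/
example : vbPlus pureCell 11 = some (-11) ∧ casLBPlus pureCell 11 = -20 ∧ casLBKPlus pureCell 11 = -19 := by
  refine ⟨by decide, by decide, by decide⟩

/-- `palCell = (30; 12,9,9,7,7,7,7)` at `p = 11` (Parts IV/V: the dominant classes `u = ±1` fire, `wLBpal = −6`, `LB = −17`,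
`refund − N_p = −18`): `rowMinK = −6`, `LB_K = −16 = LB⁺`, `LB_K⁺ = −15`.  (Exact: `v₁₁(Cas_j) = −14`, all `j`.) -/
example : rowMinK palCell 11 = some (-6) ∧ casLBK palCell 11 = -16 ∧ casLB palCell 11 = -17 ∧
    vbPlus palCell 11 = some (-9) ∧ casLBPlus palCell 11 = -16 ∧ casLBKPlus palCell 11 = -15 := by
  refine ⟨by decide, by decide, by decide, by decide, by decide, by decide⟩

/-- `exCell = (28; 10,9,9,8,7,7,7)` at `p = 11` (Part IV: the dominant configuration `{(16,−3),(38,−5)}` is NOT palindromic): no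
bonus of either kind, `LB = LB_K = LB⁺ = LB_K⁺ = −13`.  (Exact: `v₁₁(Cas_j) = −13`, all `j` — THEOREM LB is attained.) -/
example : casLB exCell 11 = -13 ∧ casLBK exCell 11 = -13 ∧ casLBPlus exCell 11 = -13 ∧ casLBKPlus exCell 11 = -13 := by
  refine ⟨by decide, by decide, by decide, by decide⟩

end CasKExamples

end Summit.KontsevichZagierPeriods.Zeta5Search.DenomLaw.ThresholdModel.Rho
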